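import Summits.ValiantsHypothesis.ValiantsHypothesis.Theses.DetQP
import Literature.Barriers.ValiantsHypothesis.GCTMatrixPowering

/-!
# Sketch — crux-ideate stmt-ValiantsHypothesis-0318 (`DetQP.DetqpSuperquadratic`), ideator 1

First lemmas of the idea cards (statements only; `def … : Prop`), elaborated against the tree.
-/

noncomputable section

namespace Summit.ValiantsHypothesis.ValiantsHypothesis.Cruxes.DetqpSuperquadratic.Ideator1

open Literature.Computability.AlgebraicComplexity
open Literature.Barriers.ValiantsHypothesis (HasPowTraceRepr powTraceComplexity)
open MvPolynomial Matrix

/-! ## Card A — linear homogenisation (bordered adjugate unrolling) -/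

/-- A1 (first lemma, provable now from `vonzurGathen1987_perm_detRepr_rank_holds`):
every affine determinantal representation of `per_n` (`n ≥ 3`) of size `m` yields a power-trace
representation of size `2m - 1`: `pc(per_n) ≤ 2·dc(per_n) - 1`. -/
def LinearHomogenisation : Prop :=
  ∀ n : ℕ, 3 ≤ n → ∀ m : ℕ, HasDetRepr (perPoly (Fin n) ℂ) m →
    HasPowTraceRepr ℂ (perPoly (Fin n) ℂ) n (2 * m - 1)

/-- A2 (the repeated-matrix form behind A1): `per_n = rᵀ L^{n-2} c` with `r, c, L` LINEAR of
width `m - 1` whenever `dc(per_n) ≤ m` (bordered normal form + homogeneity; sign absorbed in `r`). -/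
def RepeatedMatrixForm : Prop :=
  ∀ n : ℕ, 3 ≤ n → ∀ m : ℕ, HasDetRepr (perPoly (Fin n) ℂ) m →
    ∃ (r c : Fin (m - 1) → MvPolynomial (Fin n × Fin n) ℂ)
      (L : Matrix (Fin (m - 1)) (Fin (m - 1)) (MvPolynomial (Fin n × Fin n) ℂ)),
      (∀ i, (r i).IsHomogeneous 1) ∧ (∀ i, (c i).IsHomogeneous 1) ∧
      (∀ i j, (L i j).IsHomogeneous 1) ∧
      dotProduct r ((L ^ (n - 2)).mulVec c) = perPoly (Fin n) ℂ

/-- A3 (bordered normal form with the exact vanishing pattern): in the situation of A2 one can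
moreover take `rᵀ L^k c = 0` for all `k < n - 2` and `det [[0, rᵀ],[c, 1 + L]] = per_n`. -/
def BorderedNormalForm : Prop :=
  ∀ n : ℕ, 3 ≤ n → ∀ m : ℕ, HasDetRepr (perPoly (Fin n) ℂ) m →
    ∃ (r c : Fin (m - 1) → MvPolynomial (Fin n × Fin n) ℂ)
      (L : Matrix (Fin (m - 1)) (Fin (m - 1)) (MvPolynomial (Fin n × Fin n) ℂ)),
      (∀ i, (r i).IsHomogeneous 1) ∧ (∀ i, (c i).IsHomogeneous 1) ∧
      (∀ i j, (L i j).IsHomogeneous 1) ∧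
      (∀ k : ℕ, k + 2 < n → dotProduct r ((L ^ k).mulVec c) = 0) ∧
      (Matrix.fromBlocks (0 : Matrix (Fin 1) (Fin 1) (MvPolynomial (Fin n × Fin n) ℂ))
          (Matrix.of fun (_ : Fin 1) j => r j) (Matrix.of fun i (_ : Fin 1) => c i) (1 + L)).det
        = perPoly (Fin n) ℂ

/-- The transfer target C⁺ of card A: super-quadratic POWER-TRACE complexity. -/
def PcSuperquadratic : Prop :=
  ∃ ε : ℝ, 0 < ε ∧ ∃ n₀ : ℕ, ∀ n ≥ n₀,
    2 * (n : ℝ) ^ (2 + ε) ≤ (powTraceComplexity ℂ (perPoly (Fin n) ℂ) n : ℝ)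

/-- Transfer A: C⁺ ⇒ the crux (via A1: `dc ≥ (pc + 1)/2`). -/
def TransferA : Prop :=
  PcSuperquadratic → Summit.ValiantsHypothesis.ValiantsHypothesis.Theses.DetQP.DetqpSuperquadratic

/-! ## Card B — half-symmetry ladder / moduli pincer -/

/-- The bi-torus `T^E × T^F` acting on the `n²` variables by `x_ij ↦ a_i b_j x_ij` (contains the
scalings; its intersection with `G_per` is the stabiliser torus of dimension `2n - 2`). -/
def biTorus (n : ℕ) : Subgroup (GL (Fin n × Fin n) ℂ) :=
  Subgroup.closure
    {γ | ∃ a b : Fin n → ℂ, (∀ i, a i ≠ 0) ∧ (∀ j, b j ≠ 0) ∧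
      (γ : Matrix (Fin n × Fin n) (Fin n × Fin n) ℂ) = Matrix.diagonal fun ij => a ij.1 * b ij.2}

/-- The sub-torus of `biTorus n` of codimension `δ` in which the first `δ + 1` ROW scalings are
tied together (`a_0 = a_1 = ⋯ = a_δ`). -/
def rowTiedBiTorus (n δ : ℕ) : Subgroup (GL (Fin n × Fin n) ℂ) :=
  Subgroup.closure
    {γ | ∃ a b : Fin n → ℂ, (∀ i, a i ≠ 0) ∧ (∀ j, b j ≠ 0) ∧
      (∀ i i' : Fin n, (i : ℕ) ≤ δ → (i' : ℕ) ≤ δ → a i = a i') ∧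
      (γ : Matrix (Fin n × Fin n) (Fin n × Fin n) ℂ) = Matrix.diagonal fun ij => a ij.1 * b ij.2}

/-- B1 (rung δ = 0; in cone via card rigidity-implies-grenet, here the base of the ladder):
bi-torus-equivariant affine representations of `per_n` have size `≥ 2^n - 1` (Grenet is optimal
among them). Proof sketch: vzG corank-1 ⇒ graded bordered form ⇒ L nilpotent ⇒ paths graded by
`(S, π S)` ⇒ `#vertices at level k ≥ C(n,k)`. -/
def BiTorusLowerBound : Prop :=
  ∀ n : ℕ, 3 ≤ n → ∀ m : ℕ,
    HasEquivariantDetRepr (biTorus n) (perPoly (Fin n) ℂ) m → 2 ^ n - 1 ≤ m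

/-- B2 (the LADDER, first new rung): equivariance under a codimension-`δ` sub-torus still forces
`m ≥ 2^(n-δ-1)` (covering bound with ambiguity `≤ 2^(δ+1)` per vertex grade). -/
def TorusLadder : Prop :=
  ∀ n : ℕ, 3 ≤ n → ∀ δ : ℕ, δ < n → ∀ m : ℕ,
    HasEquivariantDetRepr (rowTiedBiTorus n δ) (perPoly (Fin n) ℂ) m → 2 ^ (n - δ - 1) ≤ m


/-! ## Card C — Kronecker copy number (two-sided flattening of the linear part) -/

/-- `HasKroneckerRepr n R`: a KRONECKER representation of `per_n` with `R` copies — a base point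
`p` (a complex matrix with `per p ≠ 0` forces itself), a constant `C ∈ M_{Rn}(ℂ)` and a scalar
`a ≠ 0` with `per_n(p + X) = a · det(I_{Rn} + C · (I_R ⊗ X))`. -/
def HasKroneckerRepr (n R : ℕ) : Prop :=
  ∃ (p : Fin n × Fin n → ℂ) (C : Matrix (Fin R × Fin n) (Fin R × Fin n) ℂ) (a : ℂ), a ≠ 0 ∧
    MvPolynomial.aeval (fun e : Fin n × Fin n => MvPolynomial.X e + MvPolynomial.C (p e))
        (perPoly (Fin n) ℂ)
      = MvPolynomial.C a *
        (1 + C.map (fun z : ℂ => (MvPolynomial.C z : MvPolynomial (Fin n × Fin n) ℂ)) *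
              Matrix.kroneckerMap (· * ·) (1 : Matrix (Fin R) (Fin R) (MvPolynomial (Fin n × Fin n) ℂ))
                (Matrix.mvPolynomialX (Fin n) (Fin n) ℂ)).det

/-- C1 (normal form, provable now: flattening `L(X) = Σ_{k ≤ R} P_k X Q_k` with `R ≤ n·m`,
shift to a base point, Sylvester `det(1 + UV) = det(1 + VU)`): `kc(per_n) ≤ n · dc(per_n)`. -/
def KroneckerNormalForm : Prop :=
  ∀ n : ℕ, 3 ≤ n → ∀ m : ℕ, HasDetRepr (perPoly (Fin n) ℂ) m → ∃ R ≤ n * m, HasKroneckerRepr n R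

/-- C2 (first rung, provable now): `kc(per_n) ≥ n` — products of `< n` minors of total size `n`
vanish on rank-one matrices while `per_n(u vᵀ) = n! ∏ uᵢ ∏ vⱼ`; equivalently `per_n` spans the
`Symⁿ ⊗ Symⁿ` Cauchy component (`λ = (n)`), `det_n` the `Λⁿ ⊗ Λⁿ` one (`λ = (1ⁿ)`, `kc = 1`). -/
def KroneckerFirstRung : Prop :=
  ∀ n : ℕ, 1 ≤ n → ∀ R : ℕ, HasKroneckerRepr n R → n ≤ R

/-- C3 (converse bookkeeping): a Kronecker representation with `R` copies is an affine
determinantal representation of size `R·n` (after undoing the shift), so `dc ≤ n · kc`. -/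
def KroneckerToDc : Prop :=
  ∀ n R : ℕ, HasKroneckerRepr n R → HasDetRepr (perPoly (Fin n) ℂ) (R * n)

/-- Transfer C: `kc(per_n) ≥ n^(3+ε)` eventually ⇒ the crux (via C1). -/
def TransferC : Prop :=
  (∃ ε : ℝ, 0 < ε ∧ ∃ n₀ : ℕ, ∀ n ≥ n₀, ∀ R : ℕ, HasKroneckerRepr n R → (n : ℝ) ^ (3 + ε) ≤ R) →
    Summit.ValiantsHypothesis.ValiantsHypothesis.Theses.DetQP.DetqpSuperquadratic

end Summit.ValiantsHypothesis.ValiantsHypothesis.Cruxes.DetqpSuperquadratic.Ideator1
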